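import Summits.AtomisticToContinuum.BoseEinsteinCondensation.Theses.BECParticleIncrement
import Summits.AtomisticToContinuum.BoseEinsteinCondensation.Theorems.BECParticleIncrementStepInduction

/-!
# Line `split` — crux `IncrementBound` (stmt-AtomisticToContinuum-12320), route `BECParticleIncrement`

Crux-strategist skeleton recording the BC2 REDIRECT of the restated deciding crux: `IncrementBound`
(per-particle increment `λ_max(γ_{M+1}) ≥ λ_max(γ_M) + 1/2` throughout the dilute range of the fixed
Dirichlet box — at least summit strength, c = 1/2) is NOT attacked directly; it is DERIVED from the
route's three open pieces, which are this line's registered stubs BY NAME (they are the route's own crux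
items, so no statement is re-typed here):

* `stub_gpWindowIncrement : GPWindowIncrement` (stmt-12323, rank 4, XL) — base regime, the increment in
  the Gross–Pitaevskii window `(M+1)a ≤ g₀L` (birth skeleton `Lines/split_birth_GPWindowIncrement.lean`:
  few-body rungs + GP asymptotic rungs).
* `stub_staticResponseBound : StaticResponseBound` (stmt-12322, rank 3, open-problem) — uniform static
  density-response bound of the true ground state at every `M ≤ ρ₁L³` (birth skeleton
  `Lines/split_birth_StaticResponseBound.lean`: kinetic branch + phonon branch at the healing scale).
* `stub_bootstrapStep : BootstrapStep` (stmt-12321, rank 2, open-problem) — the bulk-regime inductive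
  step given the induction hypothesis and the response inequality (birth skeleton
  `Lines/split_birth_BootstrapStep.lean`: robust top mode of the bath + occupation transfer onto it).

`IncrementBound_of : GPWindowIncrement → StaticResponseBound → BootstrapStep → IncrementBound` is the
NON-TRIVIAL assembly (≈ 55 lines, kernel-checked, no sorry): STRONG INDUCTION on the particle number `M`
inside the fixed box with the regime split `(M+1)a ≤ max g₀ 1 · L` (GP window, base) / `>` (bulk,
`BootstrapStep` fed by (i) the increments below `M` = induction hypothesis, (ii) their telescoped form
`M'/2 ≤ λ_max(γ_{M'})`, (iii) the response inequality at every `M' ≤ M+1 ≤ ρ₁L³ ≤ ρ_S L³`), constants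
`ρ₁ := min ρ_S ρ_B`, `L₀ := max (max L_S L_B) (max L_G 1)`; the finiteness of the scattering length
(proved support `ScatteringLengthFinite`, stmt-9006) is discharged by `ScatteringLengthFinite_holds`. It is
the route's landed glue `becParticleIncrement_stepInduction_proof` (stmt-12324, Theorems/
BECParticleIncrementStepInduction.lean) with that hypothesis removed.

BC2 per-piece probes (planner folder `bc/`, `lean check`, 400k heartbeats,
`exact? | simpa [C] | (unfold C; simpa) | aesop | intro h; exact?`): `Xᵢ → BoseEinsteinCondensation` FAILS 3/3,
`Xᵢ → IncrementBound` FAILS 3/3 (unsolved goals / `exact?` could not close the goal / aesop exhaustive search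
failed); converses `S → Xᵢ`, `IncrementBound → Xᵢ` also fail by the cheap tactics (by hand,
`IncrementBound → BootstrapStep` and, for `a > 0`, `IncrementBound → GPWindowIncrement` hold: both are
CONSEQUENCES of X used toward X — allowed; `StaticResponseBound` is incomparable with X and S).
Disproof.lean: none exists for this crux (`ledger crux ls`: no workfiles before this line). Negatives index
(BEC): only `BECSwapAffinity.SwapJensen`, unrelated.
-/

namespace Summit.AtomisticToContinuum.BoseEinsteinCondensation.Cruxes.IncrementBound.Split

open Literature.MathematicalPhysics.QuantumManyBody.BoseGas
open Summit.AtomisticToContinuum.BoseEinsteinCondensation.Theses.BECParticleIncrement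

/-! ### Registered stubs = the route's open pieces, by name -/

/-- **Stub = piece `GPWindowIncrement`** (stmt-AtomisticToContinuum-12323; XL): the increment in the
Gross–Pitaevskii window of the fixed Dirichlet cube. -/
theorem stub_gpWindowIncrement : GPWindowIncrement := by
  sorry

/-- **Stub = piece `StaticResponseBound`** (stmt-AtomisticToContinuum-12322; open-problem): the uniform
static density-response bound of the true ground state in the dilute fixed box. -/
theorem stub_staticResponseBound : StaticResponseBound := by
  sorry

/-- **Stub = piece `BootstrapStep`** (stmt-AtomisticToContinuum-12321; open-problem): the bulk-regime
inductive step as a one-impurity problem with the bath certified by the induction hypothesis and the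
response inequality. -/
theorem stub_bootstrapStep : BootstrapStep := by
  sorry

/-! ### The assembly (non-trivial seam: strong induction on `M` with a regime split) -/

/-- Arithmetic of one half in `ℝ≥0∞`: `ofReal ((m + 1) / 2) = ofReal (m / 2) + 2⁻¹` (`m : ℕ`). -/
theorem ofReal_succ_half (m : ℕ) :
    ENNReal.ofReal (((m + 1 : ℕ) : ℝ) / 2) = ENNReal.ofReal ((m : ℝ) / 2) + 2⁻¹ := by
  have h2 : (2⁻¹ : ENNReal) = ENNReal.ofReal ((1 : ℝ) / 2) := by
    rw [one_div, ENNReal.ofReal_inv_of_pos (by norm_num : (0 : ℝ) < 2), ENNReal.ofReal_ofNat]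
  rw [h2, ← ENNReal.ofReal_add (by positivity) (by positivity)]
  congr 1
  push_cast
  ring

/-- **`IncrementBound` from its three pieces** (the BC2-redirect assembly; concludes the crux BY NAME).
Strong induction on the particle number in the fixed Dirichlet box, regime split at
`(M+1)a = max g₀ 1 · L`, finiteness of the scattering length discharged by the proved support. -/
theorem IncrementBound_of :
    GPWindowIncrement → StaticResponseBound → BootstrapStep → IncrementBound := by
  unfold Theses.BECParticleIncrement.IncrementBound
  intro hG hS hB v hv
  -- finiteness of the scattering length (proved support item of the route)
  have hA : scatteringLength v ≠ ⊤ := ScatteringLengthFinite_holds v hv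
  -- the constant (and dilute range) of the static-response bound
  obtain ⟨C, ρS, LS, hρS, hSv⟩ := hS v hv
  -- the bulk-regime step at that constant
  obtain ⟨g₀, ρB, LB, hρB, hBv⟩ := hB v hv C
  -- the Gross–Pitaevskii window at the ratio `max g₀ 1 > 0`
  obtain ⟨LG, hGv⟩ := hG v hv hA (max g₀ 1) (lt_of_lt_of_le one_pos (le_max_right g₀ 1))
  refine ⟨min ρS ρB, max (max LS LB) (max LG 1), lt_min hρS hρB, ?_⟩
  intro L hL
  have hLS : LS ≤ L := le_trans (le_trans (le_max_left LS LB) (le_max_left _ _)) hL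
  have hLB : LB ≤ L := le_trans (le_trans (le_max_right LS LB) (le_max_left _ _)) hL
  have hLG : LG ≤ L := le_trans (le_trans (le_max_left LG 1) (le_max_right _ _)) hL
  have hL1 : (1 : ℝ) ≤ L := le_trans (le_trans (le_max_right LG 1) (le_max_right _ _)) hL
  have hL0 : (0 : ℝ) ≤ L := le_trans zero_le_one hL1
  have hL3 : (0 : ℝ) ≤ L ^ 3 := pow_nonneg hL0 3
  have hρSL : min ρS ρB * L ^ 3 ≤ ρS * L ^ 3 := mul_le_mul_of_nonneg_right (min_le_left _ _) hL3
  have hρBL : min ρS ρB * L ^ 3 ≤ ρB * L ^ 3 := mul_le_mul_of_nonneg_right (min_le_right _ _) hL3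
  intro M
  -- strong induction on the particle number inside the fixed box
  induction M using Nat.strong_induction_on with
  | _ M ih =>
    intro hM
    by_cases hgp : ((M : ℝ) + 1) * (scatteringLength v).toReal ≤ max g₀ 1 * L
    · -- Gross–Pitaevskii window: the base regime
      exact hGv L hLG M hgp
    · -- bulk regime: `BootstrapStep`
      push Not at hgp
      have hg : g₀ * L < ((M : ℝ) + 1) * (scatteringLength v).toReal :=
        lt_of_le_of_lt (mul_le_mul_of_nonneg_right (le_max_left g₀ 1) hL0) hgp
      have hMB : (M : ℝ) + 1 ≤ ρB * L ^ 3 := le_trans hM hρBL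
      -- (i) increments below `M`: the induction hypothesis
      have hinc : ∀ M' : ℕ, M' < M →
          condensateNumber v M' L + 2⁻¹ ≤ condensateNumber v (M' + 1) L := by
        intro M' hM'
        refine ih M' hM' ?_
        have h1 : (M' : ℝ) + 1 ≤ (M : ℝ) := by exact_mod_cast hM'
        linarith
      -- (ii) telescoped: `M'/2 ≤ λ_max(γ_{M'})` for all `M' ≤ M`
      have htel : ∀ M' : ℕ, M' ≤ M →
          ENNReal.ofReal ((M' : ℝ) / 2) ≤ condensateNumber v M' L := by
        intro M'
        induction M' with
        | zero => intro _; simp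
        | succ m ihm =>
          intro hm
          calc ENNReal.ofReal (((m + 1 : ℕ) : ℝ) / 2)
              = ENNReal.ofReal ((m : ℝ) / 2) + 2⁻¹ := ofReal_succ_half m
            _ ≤ condensateNumber v m L + 2⁻¹ := add_le_add (ihm (Nat.le_of_succ_le hm)) le_rfl
            _ ≤ condensateNumber v (m + 1) L := hinc m (Nat.lt_of_succ_le hm)
      -- (iii) the static-response inequality at every `M' ≤ M + 1 ≤ ρ₁ L³ ≤ ρS L³`
      have hresp := fun (M' : ℕ) (hM' : M' ≤ M + 1) =>
        hSv L hLS M' (by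
          have h1 : (M' : ℝ) ≤ (M : ℝ) + 1 := by exact_mod_cast hM'
          linarith)
      exact hBv L hLB M hg hMB htel hinc hresp

/-- The same assembly through the route's LANDED glue `StepInduction` (stmt-12324) — the two agree. -/
theorem IncrementBound_of' :
    GPWindowIncrement → StaticResponseBound → BootstrapStep → IncrementBound :=
  fun hG hS hB =>
    Summit.AtomisticToContinuum.BoseEinsteinCondensation.Theorems.becParticleIncrement_stepInduction_proof
      hG ScatteringLengthFinite_holds hS hB

/-- The crux, from the registered stubs. -/
theorem IncrementBound_proof : IncrementBound :=
  IncrementBound_of stub_gpWindowIncrement stub_staticResponseBound stub_bootstrapStep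

end Summit.AtomisticToContinuum.BoseEinsteinCondensation.Cruxes.IncrementBound.Split
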